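import Mathlib.Data.Real.Basic
import Mathlib.Tactic.Linarith
import Mathlib.Tactic.Positivity
import Mathlib.Tactic.Ring
import Mathlib.Tactic.FieldSimp
import Summits.CriticalPhenomena.PercolationContinuityZ3.Theorems.PercNearOneGluingNoHeavyLowerTailAPLConjFUnionCC
import HarnessLib

/-!
# `NoHeavyLowerTail` (stmt-CriticalPhenomena-4575) — CONJECTURE F under apex piece-union: cell form of the easy aligned leaf

Support file (prover prim-ineq-gen-8 gen 35; `--supports stmt-CriticalPhenomena-4575`; memo
run/shared/lean/prim/prim-ineq-gen-8/FINDING-gen35-CONJF-UNION.md §5).  Pure real algebra: no definitions, no named facts, no sorries.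

Cell form of `conjF_c_union_cc_norm` (`…APLConjFUnionCC.lean`): for nonnegative cell vectors `u = (u0,uab,uac,ubc,u3)` and `v`, both
c-leaning (`uab ≤ uac`, `vab ≤ vac`), with `uab+uac ≤ 2u0` and the APL(2/3) row `3e·S ≥ 2D·T` for both pieces (`e = uab+uac`,
`D = u0+e`, `T = e+u3`, `S` the total mass), the apex piece-union `w` satisfies `F_c(w) ≥ 0`.  By the `b ↔ c` relabelling this is
also `F_b` of the union of two b-leaning pieces.  (The light case `uab+uac ≥ 2u0` is gen 34's `conjF_c_union_of_light`.) [folklore algebra]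
-/

namespace Summit.CriticalPhenomena.PercolationContinuityZ3.Theorems

namespace APL

set_option maxHeartbeats 1600000 in
/-- **LEMMA U″ (easy aligned leaf) in cells.**  `u, v ≥ 0` both c-leaning (`uab ≤ uac`, `vab ≤ vac`), `uab+uac ≤ 2u0`, and
APL(2/3) `2D_uT_u ≤ 3e_uS_u`, `2D_vT_v ≤ 3e_vS_v`.  Then the apex piece-union `w` satisfies `F_c(w) ≥ 0`. [folklore] -/
theorem conjF_c_union_cc (u0 uab uac ubc u3 v0 vab vac vbc v3 : ℝ)
    (hu0 : 0 ≤ u0) (huab : 0 ≤ uab) (huac : 0 ≤ uac) (hubc : 0 ≤ ubc) (hu3 : 0 ≤ u3)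
    (hv0 : 0 ≤ v0) (hvab : 0 ≤ vab) (hvac : 0 ≤ vac) (hvbc : 0 ≤ vbc) (hv3 : 0 ≤ v3)
    (huc : uab ≤ uac) (hue : uab + uac ≤ 2*u0)
    (hAu : 2*(u0+uab+uac)*(uab+uac+u3) ≤ 3*(uab+uac)*(u0+uab+uac+ubc+u3))
    (hvc : vab ≤ vac)
    (hAv : 2*(v0+vab+vac)*(vab+vac+v3) ≤ 3*(vab+vac)*(v0+vab+vac+vbc+v3)) :
    0 ≤ 3*((u0*vab+uab*v0+uab*vab)+(u0*vac+uac*v0+uac*vac))*(u0*v0+(u0*vab+uab*v0+uab*vab)+(u0*vac+uac*v0+uac*vac)+(u0*vbc+ubc*v0+ubc*vbc)+(u3*(v0+vab+vac+vbc+v3)+(u0+uab+uac+ubc+u3)*v3-u3*v3+uab*(vac+vbc)+uac*(vab+vbc)+ubc*(vab+vac))) - (u0*v0+(u0*vab+uab*v0+uab*vab)+(u0*vac+uac*v0+uac*vac))*(3*(u0*vab+uab*v0+uab*vab)+(u0*vac+uac*v0+uac*vac)+2*(u3*(v0+vab+vac+vbc+v3)+(u0+uab+uac+ubc+u3)*v3-u3*v3+uab*(vac+vbc)+uac*(vab+vbc)+ubc*(vab+vac)))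 := by
  have poly : 3*((u0*vab+uab*v0+uab*vab)+(u0*vac+uac*v0+uac*vac))*(u0*v0+(u0*vab+uab*v0+uab*vab)+(u0*vac+uac*v0+uac*vac)+(u0*vbc+ubc*v0+ubc*vbc)+(u3*(v0+vab+vac+vbc+v3)+(u0+uab+uac+ubc+u3)*v3-u3*v3+uab*(vac+vbc)+uac*(vab+vbc)+ubc*(vab+vac))) - (u0*v0+(u0*vab+uab*v0+uab*vab)+(u0*vac+uac*v0+uac*vac))*(3*(u0*vab+uab*v0+uab*vab)+(u0*vac+uac*v0+uac*vac)+2*(u3*(v0+vab+vac+vbc+v3)+(u0+uab+uac+ubc+u3)*v3-u3*v3+uab*(vac+vbc)+uac*(vab+vbc)+ubc*(vab+vac)))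
      = ((u0+uab+uac)*(v0+vab+vac) - (uab*vac+uac*vab))
          * ((u0+uab+uac+ubc+u3)*(v0+vab+vac+vbc+v3) + 2*(u0+ubc)*(v0+vbc)
              - ((uab-uac)*((v0+vab+vac) - (vab+vac)/2) - (vac-vab)*((u0+uab+uac) - (uab+uac)/2)))
        - 3*u0*v0*(u0+uab+uac+ubc+u3)*(v0+vab+vac+vbc+v3) := by
    ring
  rw [poly]
  rcases eq_or_lt_of_le (show 0 ≤ u0+uab+uac by positivity) with hDu | hDu
  · have e0 : u0 = 0 := by linarith
    have e1 : uab = 0 := by linarith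
    have e2 : uac = 0 := by linarith
    subst e0 e1 e2
    norm_num
  rcases eq_or_lt_of_le (show 0 ≤ v0+vab+vac by positivity) with hDv | hDv
  · have e0 : v0 = 0 := by linarith
    have e1 : vab = 0 := by linarith
    have e2 : vac = 0 := by linarith
    subst e0 e1 e2
    norm_num
  have hSu : 0 < u0+uab+uac+ubc+u3 := by linarith
  have hSv : 0 < v0+vab+vac+vbc+v3 := by linarith
  have hDu0 : u0+uab+uac ≠ 0 := ne_of_gt hDu
  have hDv0 : v0+vab+vac ≠ 0 := ne_of_gt hDv
  have hSu0 : u0+uab+uac+ubc+u3 ≠ 0 := ne_of_gt hSu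
  have hSv0 : v0+vab+vac+vbc+v3 ≠ 0 := ne_of_gt hSv
  have h_x : 0 ≤ uab/(u0+uab+uac) := div_nonneg huab hDu.le
  have h_xy : uab/(u0+uab+uac) ≤ uac/(u0+uab+uac) := div_le_div_of_nonneg_right huc hDu.le
  have h_Q : uab/(u0+uab+uac) + uac/(u0+uab+uac) ≤ 2/3 := by
    rw [← add_div, div_le_iff₀ hDu]; linarith
  have h_D : 0 ≤ (u0+uab+uac)/(u0+uab+uac+ubc+u3) := div_nonneg hDu.le hSu.le
  have h_s : 2*((uab+uac+u3)/(u0+uab+uac+ubc+u3)) ≤ 3*(uab/(u0+uab+uac) + uac/(u0+uab+uac)) := by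
    rw [← add_div, ← mul_div_assoc, ← mul_div_assoc, div_le_div_iff₀ hSu hDu]; linarith
  have h_x' : 0 ≤ vab/(v0+vab+vac) := div_nonneg hvab hDv.le
  have h_xy' : vab/(v0+vab+vac) ≤ vac/(v0+vab+vac) := div_le_div_of_nonneg_right hvc hDv.le
  have h_Q' : vab/(v0+vab+vac) + vac/(v0+vab+vac) ≤ 1 := by
    rw [← add_div, div_le_one hDv]; linarith
  have h_D' : 0 ≤ (v0+vab+vac)/(v0+vab+vac+vbc+v3) := div_nonneg hDv.le hSv.le
  have h_s' : 2*((vab+vac+v3)/(v0+vab+vac+vbc+v3)) ≤ 3*(vab/(v0+vab+vac) + vac/(v0+vab+vac)) := by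
    rw [← add_div, ← mul_div_assoc, ← mul_div_assoc, div_le_div_iff₀ hSv hDv]; linarith
  have h_a' : (vab+vac+v3)/(v0+vab+vac+vbc+v3) ≤ 1 := by
    rw [div_le_one hSv]; linarith
  have key := conjF_c_union_cc_norm
    ((u0+uab+uac)/(u0+uab+uac+ubc+u3)) (uab/(u0+uab+uac)) (uac/(u0+uab+uac)) ((uab+uac+u3)/(u0+uab+uac+ubc+u3))
    ((v0+vab+vac)/(v0+vab+vac+vbc+v3)) (vab/(v0+vab+vac)) (vac/(v0+vab+vac)) ((vab+vac+v3)/(v0+vab+vac+vbc+v3))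
    h_x h_xy h_Q h_D h_s h_x' h_xy' h_Q' h_D' h_s' h_a'
  have bridge : ((u0+uab+uac)*(v0+vab+vac) - (uab*vac+uac*vab))
          * ((u0+uab+uac+ubc+u3)*(v0+vab+vac+vbc+v3) + 2*(u0+ubc)*(v0+vbc)
              - ((uab-uac)*((v0+vab+vac) - (vab+vac)/2) - (vac-vab)*((u0+uab+uac) - (uab+uac)/2)))
        - 3*u0*v0*(u0+uab+uac+ubc+u3)*(v0+vab+vac+vbc+v3)
      = ((u0+uab+uac)*(v0+vab+vac)*(u0+uab+uac+ubc+u3)*(v0+vab+vac+vbc+v3))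
        * ((1 - (uab/(u0+uab+uac)*(vac/(v0+vab+vac)) + uac/(u0+uab+uac)*(vab/(v0+vab+vac))))
            * (1 + 2*(1-(uab+uac+u3)/(u0+uab+uac+ubc+u3))*(1-(vab+vac+v3)/(v0+vab+vac+vbc+v3))
              - (u0+uab+uac)/(u0+uab+uac+ubc+u3)*((v0+vab+vac)/(v0+vab+vac+vbc+v3))
                *((uab/(u0+uab+uac)-uac/(u0+uab+uac))*(1-(vab/(v0+vab+vac)+vac/(v0+vab+vac))/2)
                  - (vac/(v0+vab+vac)-vab/(v0+vab+vac))*(1-(uab/(u0+uab+uac)+uac/(u0+uab+uac))/2)))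
          - 3*(1-(uab/(u0+uab+uac)+uac/(u0+uab+uac)))*(1-(vab/(v0+vab+vac)+vac/(v0+vab+vac)))) := by
    field_simp
    ring
  rw [bridge]
  exact mul_nonneg (by positivity) key

end APL

end Summit.CriticalPhenomena.PercolationContinuityZ3.Theorems
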